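import Summits.CriticalPhenomena.PercolationContinuityZ3.Theorems.PercNearOneGluingNoHeavyLowerTailCILPeeling
import Literature.Probability.LatticeModels.ProdBernoulliAtomExpansion
import HarnessLib

/-!
# `NoHeavyLowerTail` (stmt-CriticalPhenomena-4575) — tools for the hyperedge reduction of the two-sided core: the star of a
# two-port vertex

Support file (prover `prim-hp-2`, deletion–contraction / pivotal-edge line; `--supports stmt-CriticalPhenomena-4575`).
No definitions, no named facts, no sorries.  Companion of `…CILHyperedgeReduction` (which carries the statement and the story).

Notation: `μ_w = prodBernoulli w` on `Fin n`, relays `A`, level `j`, `π(v) = {z ∈ A : v ↔ z}`, `π(S) = ⋃_{v∈S} π(v)`, events "off `v`"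
read on `ω ∩ {e | v ∉ e}`, `σ_B` the star event of a vertex (`starEvent`).  For a vertex `s₂` all of whose positive-weight pairs end in
two vertices `c ≠ d` (a TWO-PORT vertex, coins `y_c, y_d`):

* `Hyperedge.measureReal_starEvent_twoPort` (`_cases`) — `μ(σ_B) = (c∈B ? y_c : 1−y_c)(d∈B ? y_d : 1−y_d)` for `B ⊆ {c,d}`;
* `Hyperedge.setCS_pair_star_expansion` — for `S = {s₁,s₂}` and any finite port set `P` of `s₂`: the `CS`-difference
  `μ(i ↮ S, |π(i)| ≤ j) − μ(i ↮ S, 1 ≤ |π(S)| ≤ j)` equals `Σ_{B ⊆ P} μ(σ_B)·[same difference off s₂ for the observer set {s₁} ∪ B]`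
  (exact deletion–contraction over the edges at `s₂`: `KNPreFKG.real_eq_sum_inter_starEvent`, `CutObserver.exists_reachable_set_iff_star`,
  `CutObserver.measureReal_starEvent_inter_avoid`);
* `Hyperedge.pair_expansion_twoPort` — its two-port form, with the off-`s₂` terms computed under any weight function agreeing off `s₂`;
* `Hyperedge.sum_powerset_pair` — `Σ_{B ⊆ {c,d}} F B` written out.
-/

noncomputable section

namespace Summit.CriticalPhenomena.PercolationContinuityZ3.Theorems

open MeasureTheory Set Literature.Probability.LatticeModels Literature.Probability.Percolation
open scoped Classical BigOperators

variable {n : ℕ}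

namespace Hyperedge

open CutObserver KNPreFKG

/-! ### Star probabilities of a two-port vertex -/

/-- If every positive-weight pair at `o` ends in `c` or `d` (`c ≠ d`, both `≠ o`), then for `B ⊆ {c,d}` the star `σ_B` of `o` has
probability `(c ∈ B ? w_{oc} : 1 − w_{oc})·(d ∈ B ? w_{od} : 1 − w_{od})`. [folklore; product measure, Grimmett 1999 §1.3] -/
theorem measureReal_starEvent_twoPort (w : Sym2 (Fin n) → unitInterval) (o c d : Fin n) (hco : c ≠ o) (hdo : d ≠ o)
    (hcd : c ≠ d) (hobs : ∀ u, u ≠ o → w s(o, u) ≠ 0 → u = c ∨ u = d) (B : Finset (Fin n)) (hB : B ⊆ {c, d}) :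
    (prodBernoulli w).real (starEvent o (↑B : Set (Fin n))) =
      (if c ∈ B then (w s(o, c) : ℝ) else 1 - w s(o, c)) * (if d ∈ B then (w s(o, d) : ℝ) else 1 - w s(o, d)) := by
  set μ := prodBernoulli w with hμ
  set F : Finset (Sym2 (Fin n)) := {s(o, c), s(o, d)} with hF
  set γ : Sym2 (Fin n) → Prop := fun e => (e = s(o, c) ∧ c ∈ B) ∨ (e = s(o, d) ∧ d ∈ B) with hγ
  set C : Set (BondConfig (Fin n)) := {ω | ∀ e ∈ F, (e ∈ ω ↔ γ e)} with hC
  set U : Finset (Fin n) := Finset.univ.filter fun u => u ≠ o ∧ u ≠ c ∧ u ≠ d with hU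
  set N : Set (BondConfig (Fin n)) := {ω | ∃ u ∈ U, s(o, u) ∈ ω} with hN
  have hne : s(o, c) ≠ s(o, d) := fun h => hcd (Sym2.congr_right.1 h)
  have hγc : γ s(o, c) ↔ c ∈ B := by
    constructor
    · rintro (⟨-, h⟩ | ⟨h, -⟩)
      · exact h
      · exact absurd h hne
    · exact fun h => Or.inl ⟨rfl, h⟩
  have hγd : γ s(o, d) ↔ d ∈ B := by
    constructor
    · rintro (⟨h, -⟩ | ⟨-, h⟩)
      · exact absurd h.symm hne
      · exact h
    · exact fun h => Or.inr ⟨rfl, h⟩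
  -- the star is the cylinder `C` off the null event `N`
  have hσ : starEvent o (↑B : Set (Fin n)) = C \ N := by
    ext ω
    simp only [mem_starEvent_iff, Finset.mem_coe, hC, hN, mem_sdiff, mem_setOf_eq, not_exists, not_and, hF,
      Finset.mem_insert, Finset.mem_singleton]
    constructor
    · intro h
      refine ⟨?_, fun u hu => ?_⟩
      · intro e he
        rcases he with rfl | rfl
        · rw [hγc]; exact h c hco
        · rw [hγd]; exact h d hdo
      · rw [hU, Finset.mem_filter] at hu
        intro hopen
        have := (h u hu.2.1).1 hopen
        rcases Finset.mem_insert.1 (hB this) with h' | h'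
        · exact hu.2.2.1 h'
        · exact hu.2.2.2 (Finset.mem_singleton.1 h')
    · rintro ⟨hCω, hNω⟩ u huo
      by_cases huc : u = c
      · subst huc; rw [← hγc]; exact hCω _ (Or.inl rfl)
      by_cases hud : u = d
      · subst hud; rw [← hγd]; exact hCω _ (Or.inr rfl)
      have huU : u ∈ U := Finset.mem_filter.2 ⟨Finset.mem_univ _, huo, huc, hud⟩
      constructor
      · intro h; exact absurd h (hNω u huU)
      · intro h
        rcases Finset.mem_insert.1 (hB h) with h' | h'
        · exact absurd h' huc
        · exact absurd (Finset.mem_singleton.1 h') hud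
  have hN0 : μ.real N = 0 := by
    refine le_antisymm ?_ measureReal_nonneg
    have hNU : N = ⋃ u ∈ U, {ω : BondConfig (Fin n) | s(o, u) ∈ ω} := by
      ext ω; simp [hN]
    rw [hNU]
    refine (measureReal_biUnion_finset_le _ _).trans (Finset.sum_eq_zero fun u hu => ?_).le
    rw [hU, Finset.mem_filter] at hu
    rw [hμ, prodBernoulli_real_setOf_mem]
    by_contra h
    rcases hobs u hu.2.1 (fun h' => h (by rw [h']; rfl)) with h' | h'
    · exact hu.2.2.1 h'
    · exact hu.2.2.2 h'
  have hCval : μ.real C = (if c ∈ B then (w s(o, c) : ℝ) else 1 - w s(o, c)) *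
      (if d ∈ B then (w s(o, d) : ℝ) else 1 - w s(o, d)) := by
    rw [hC, hμ, prodBernoulli_real_setOf_forall_iff, hF, Finset.prod_pair hne]
    by_cases hc : c ∈ B <;> by_cases hd : d ∈ B
    · rw [if_pos (hγc.2 hc), if_pos (hγd.2 hd), if_pos hc, if_pos hd]
    · rw [if_pos (hγc.2 hc), if_neg (fun h => hd (hγd.1 h)), if_pos hc, if_neg hd]
    · rw [if_neg (fun h => hc (hγc.1 h)), if_pos (hγd.2 hd), if_neg hc, if_pos hd]
    · rw [if_neg (fun h => hc (hγc.1 h)), if_neg (fun h => hd (hγd.1 h)), if_neg hc, if_neg hd]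
  have hdiff : μ.real (C \ N) = μ.real C := by
    have h1 : μ.real (C \ N) ≤ μ.real C := measureReal_mono sdiff_subset (measure_ne_top _ _)
    have h2 : μ.real C ≤ μ.real (C \ N) + μ.real N := by
      calc μ.real C ≤ μ.real (C \ N ∪ N) := measureReal_mono (fun ω hω => by
              by_cases h : ω ∈ N
              · exact Or.inr h
              · exact Or.inl ⟨hω, h⟩) (measure_ne_top _ _)
        _ ≤ μ.real (C \ N) + μ.real N := measureReal_union_le _ _
    rw [hN0, add_zero] at h2
    exact le_antisymm h1 h2
  rw [hσ, hdiff, hCval]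

/-- Sum of the first three star probabilities and the fourth: with `Y = w_{oc}·w_{od}`,
`μ(σ_∅) = (1 − w_{oc})(1 − w_{od})`, `μ(σ_c) = w_{oc}(1 − w_{od})`, `μ(σ_d) = (1 − w_{oc})w_{od}`, `μ(σ_{cd}) = Y`. [folklore] -/
theorem measureReal_starEvent_twoPort_cases (w : Sym2 (Fin n) → unitInterval) (o c d : Fin n) (hco : c ≠ o) (hdo : d ≠ o)
    (hcd : c ≠ d) (hobs : ∀ u, u ≠ o → w s(o, u) ≠ 0 → u = c ∨ u = d) :
    (prodBernoulli w).real (starEvent o (↑(∅ : Finset (Fin n)) : Set (Fin n))) = (1 - w s(o, c)) * (1 - w s(o, d)) ∧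
    (prodBernoulli w).real (starEvent o (↑({c} : Finset (Fin n)) : Set (Fin n))) = w s(o, c) * (1 - w s(o, d)) ∧
    (prodBernoulli w).real (starEvent o (↑({d} : Finset (Fin n)) : Set (Fin n))) = (1 - w s(o, c)) * w s(o, d) ∧
    (prodBernoulli w).real (starEvent o (↑({c, d} : Finset (Fin n)) : Set (Fin n))) = w s(o, c) * w s(o, d) := by
  refine ⟨?_, ?_, ?_, ?_⟩
  · rw [measureReal_starEvent_twoPort w o c d hco hdo hcd hobs ∅ (Finset.empty_subset _)]
    simp
  · rw [measureReal_starEvent_twoPort w o c d hco hdo hcd hobs {c} (by simp)]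
    simp [hcd.symm]
  · rw [measureReal_starEvent_twoPort w o c d hco hdo hcd hobs {d} (by simp)]
    simp [hcd]
  · rw [measureReal_starEvent_twoPort w o c d hco hdo hcd hobs {c, d} (subset_refl _)]
    simp

/-! ### The exact expansion of the pair `CS`-difference over the stars of `s₂` -/

/-- **Star expansion of the pair `CS`-difference (exact deletion–contraction over the edges at `s₂`).**  Let `S = {s₁, s₂}`
(`s₁ ≠ s₂`, `s₂ ∉ A`), `i ∉ S`, and let every positive-weight pair at `s₂` end in the finite set `P` (`s₂ ∉ P`).  Reading events off
`s₂` on `ω ∩ {e | s₂ ∉ e}` and writing `S_B = {s₁} ∪ B`: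
`μ(i ↮ S, |π(i)| ≤ j) − μ(i ↮ S, 1 ≤ |π(S)| ≤ j) = Σ_{B ⊆ P} μ(σ_B)·[μ(i ↮' S_B, |π'(i)| ≤ j) − μ(i ↮' S_B, 1 ≤ |π'(S_B)| ≤ j)]`.
Mechanism: the stars of `s₂` partition the space (`KNPreFKG.real_eq_sum_inter_starEvent`); on `σ_B` the cluster of `S` is `s₂` plus the
off-`s₂` clusters of `S_B` (`CutObserver.exists_reachable_set_iff_star`, `forall_not_reachable_set_iff_star`); the star is independent of
the configuration off `s₂` (`CutObserver.measureReal_starEvent_inter_avoid`). [folklore] -/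
theorem setCS_pair_star_expansion (w : Sym2 (Fin n) → unitInterval) (A : Finset (Fin n)) (s₁ s₂ i : Fin n)
    (P : Finset (Fin n)) (j : ℕ) (hs₂A : s₂ ∉ A) (h12 : s₁ ≠ s₂) (hi1 : i ≠ s₁) (hi2 : i ≠ s₂) (hs₂P : s₂ ∉ P)
    (hobs : ∀ u, u ≠ s₂ → u ∉ P → w s(s₂, u) = 0) :
    (prodBernoulli w).real {ω : BondConfig (Fin n) | (∀ x ∈ ({s₁, s₂} : Finset (Fin n)), ω ∉ openConn i x) ∧
        (A.filter fun z => ω ∈ openConn i z).card ≤ j} -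
      (prodBernoulli w).real {ω : BondConfig (Fin n) | (∀ x ∈ ({s₁, s₂} : Finset (Fin n)), ω ∉ openConn i x) ∧
        1 ≤ (A.filter fun z => ∃ x ∈ ({s₁, s₂} : Finset (Fin n)), ω ∈ openConn x z).card ∧
        (A.filter fun z => ∃ x ∈ ({s₁, s₂} : Finset (Fin n)), ω ∈ openConn x z).card ≤ j} =
    ∑ B ∈ P.powerset, (prodBernoulli w).real (starEvent s₂ (↑B : Set (Fin n))) *
      ((prodBernoulli w).real {ω : BondConfig (Fin n) |
          (∀ y ∈ {s₁} ∪ B, ¬ (openGraph (ω ∩ {e | s₂ ∉ e})).Reachable i y) ∧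
            (A.filter fun z => (openGraph (ω ∩ {e | s₂ ∉ e})).Reachable i z).card ≤ j} -
        (prodBernoulli w).real {ω : BondConfig (Fin n) |
          (∀ y ∈ {s₁} ∪ B, ¬ (openGraph (ω ∩ {e | s₂ ∉ e})).Reachable i y) ∧
            1 ≤ (A.filter fun z => ∃ y ∈ {s₁} ∪ B, (openGraph (ω ∩ {e | s₂ ∉ e})).Reachable y z).card ∧
            (A.filter fun z => ∃ y ∈ {s₁} ∪ B, (openGraph (ω ∩ {e | s₂ ∉ e})).Reachable y z).card ≤ j}) := by
  haveI : IsProbabilityMeasure (prodBernoulli w) := inferInstance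
  set μ := prodBernoulli w with hμ
  set S : Finset (Fin n) := {s₁, s₂} with hSdef
  have hvS : s₂ ∈ S := by simp [hSdef]
  have hiS : i ∉ S := by simp [hSdef, hi1, hi2]
  have herase : S.erase s₂ = {s₁} := by
    ext x
    simp only [hSdef, Finset.mem_erase, Finset.mem_insert, Finset.mem_singleton]
    constructor
    · rintro ⟨hne, h | h⟩
      · exact h
      · exact absurd h hne
    · intro h; exact ⟨h ▸ h12, Or.inl h⟩
  set LS := {ω : BondConfig (Fin n) | (∀ x ∈ S, ω ∉ openConn i x) ∧
    1 ≤ (A.filter fun z => ∃ x ∈ S, ω ∈ openConn x z).card ∧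
    (A.filter fun z => ∃ x ∈ S, ω ∈ openConn x z).card ≤ j} with hLS
  set RS := {ω : BondConfig (Fin n) | (∀ x ∈ S, ω ∉ openConn i x) ∧
    (A.filter fun z => ω ∈ openConn i z).card ≤ j} with hRS
  set PL : Finset (Fin n) → BondConfig (Fin n) → Prop := fun B ξ =>
    (∀ y ∈ {s₁} ∪ B, ¬ (openGraph ξ).Reachable i y) ∧
      1 ≤ (A.filter fun z => ∃ y ∈ {s₁} ∪ B, (openGraph ξ).Reachable y z).card ∧
      (A.filter fun z => ∃ y ∈ {s₁} ∪ B, (openGraph ξ).Reachable y z).card ≤ j with hPL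
  set PR : Finset (Fin n) → BondConfig (Fin n) → Prop := fun B ξ =>
    (∀ y ∈ {s₁} ∪ B, ¬ (openGraph ξ).Reachable i y) ∧ (A.filter fun z => (openGraph ξ).Reachable i z).card ≤ j with hPR
  -- per-star identities
  have hstar : ∀ B ∈ P.powerset,
      μ.real (LS ∩ starEvent s₂ (↑B : Set (Fin n))) = μ.real (starEvent s₂ (↑B : Set (Fin n))) * μ.real {ω | PL B (ω ∩ {e | s₂ ∉ e})} ∧
      μ.real (RS ∩ starEvent s₂ (↑B : Set (Fin n))) = μ.real (starEvent s₂ (↑B : Set (Fin n))) * μ.real {ω | PR B (ω ∩ {e | s₂ ∉ e})} := by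
    intro B hB
    have hBP : B ⊆ P := Finset.mem_powerset.1 hB
    have hBv : ∀ y ∈ B, y ≠ s₂ := fun y hy h => hs₂P (h ▸ hBP hy)
    set σ := starEvent s₂ (↑B : Set (Fin n)) with hσdef
    -- π(S) = π'({s₁} ∪ B) on σ (relays are ≠ s₂)
    have hfilt : ∀ ω ∈ σ, (A.filter fun z => ∃ x ∈ S, ω ∈ openConn x z) =
        (A.filter fun z => ∃ y ∈ {s₁} ∪ B, (openGraph (ω ∩ {e | s₂ ∉ e})).Reachable y z) := by
      intro ω hω
      refine Finset.filter_congr fun z hz => ?_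
      have hzv : z ≠ s₂ := fun h => hs₂A (h ▸ hz)
      have key := exists_reachable_set_iff_star hω hvS hBv hzv
      rw [herase] at key
      exact key
    -- off S, π(i) = π'(i)
    have hfiltc : ∀ ω : BondConfig (Fin n), (∀ x ∈ S, ω ∉ openConn i x) →
        (A.filter fun z => ω ∈ openConn i z) = (A.filter fun z => (openGraph (ω ∩ {e | s₂ ∉ e})).Reachable i z) := by
      intro ω h
      have hiv : ¬ (openGraph ω).Reachable i s₂ := h s₂ hvS
      refine Finset.filter_congr fun z _ => ⟨fun hz => ?_, fun hz => reachable_mono inter_subset_left hz⟩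
      exact reachable_avoiding_of_not_reachable hiv hz
    have hsepiff : ∀ ω ∈ σ, (∀ x ∈ S, ω ∉ openConn i x) ↔
        ∀ y ∈ {s₁} ∪ B, ¬ (openGraph (ω ∩ {e | s₂ ∉ e})).Reachable i y := by
      intro ω hω
      have key := forall_not_reachable_set_iff_star hω hvS hBv hiS
      rw [herase] at key
      exact key
    have hL : LS ∩ σ = σ ∩ {ω | PL B (ω ∩ {e | s₂ ∉ e})} := by
      ext ω
      simp only [hLS, mem_inter_iff, mem_setOf_eq]
      constructor
      · rintro ⟨⟨hsep, h1, h2⟩, hω⟩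
        refine ⟨hω, (hsepiff ω hω).1 hsep, ?_, ?_⟩
        · rw [← hfilt ω hω]; exact h1
        · rw [← hfilt ω hω]; exact h2
      · rintro ⟨hω, hsep, h1, h2⟩
        refine ⟨⟨(hsepiff ω hω).2 hsep, ?_, ?_⟩, hω⟩
        · rw [hfilt ω hω]; exact h1
        · rw [hfilt ω hω]; exact h2
    have hR : RS ∩ σ = σ ∩ {ω | PR B (ω ∩ {e | s₂ ∉ e})} := by
      ext ω
      simp only [hRS, mem_inter_iff, mem_setOf_eq]
      constructor
      · rintro ⟨⟨hsep, h2⟩, hω⟩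
        refine ⟨hω, (hsepiff ω hω).1 hsep, ?_⟩
        rw [← hfiltc ω hsep]; exact h2
      · rintro ⟨hω, hsep, h2⟩
        have hsep' := (hsepiff ω hω).2 hsep
        refine ⟨⟨hsep', ?_⟩, hω⟩
        rw [hfiltc ω hsep']; exact h2
    refine ⟨?_, ?_⟩
    · rw [hL, measureReal_starEvent_inter_avoid w s₂ ↑B (PL B)]
    · rw [hR, measureReal_starEvent_inter_avoid w s₂ ↑B (PR B)]
  -- sum over the stars
  have hsumL := real_eq_sum_inter_starEvent w P s₂ hs₂P hobs LS
  have hsumR := real_eq_sum_inter_starEvent w P s₂ hs₂P hobs RS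
  have hL' : μ.real LS = ∑ B ∈ P.powerset, μ.real (starEvent s₂ (↑B : Set (Fin n))) * μ.real {ω | PL B (ω ∩ {e | s₂ ∉ e})} := by
    rw [hμ] at hstar ⊢
    rw [hsumL]
    exact Finset.sum_congr rfl fun B hB => (hstar B hB).1
  have hR' : μ.real RS = ∑ B ∈ P.powerset, μ.real (starEvent s₂ (↑B : Set (Fin n))) * μ.real {ω | PR B (ω ∩ {e | s₂ ∉ e})} := by
    rw [hμ] at hstar ⊢
    rw [hsumR]
    exact Finset.sum_congr rfl fun B hB => (hstar B hB).2
  show μ.real RS - μ.real LS = _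
  rw [hL', hR', ← Finset.sum_sub_distrib]
  refine Finset.sum_congr rfl fun B _ => ?_
  rw [← mul_sub]

/-! ### A sum over the subsets of a pair -/

/-- `Σ_{B ⊆ {c,d}} F(B) = F ∅ + F {c} + F {d} + F {c,d}` for `c ≠ d`. [folklore] -/
theorem sum_powerset_pair {M : Type*} [AddCommMonoid M] (c d : Fin n) (hcd : c ≠ d) (F : Finset (Fin n) → M) :
    ∑ B ∈ ({c, d} : Finset (Fin n)).powerset, F B = F ∅ + F {c} + F {d} + F {c, d} := by
  have hc : c ∉ ({d} : Finset (Fin n)) := by simp [hcd]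
  have hd : ({d} : Finset (Fin n)) = insert d ∅ := rfl
  rw [Finset.sum_powerset_insert hc, hd, Finset.sum_powerset_insert (Finset.notMem_empty d),
    Finset.sum_powerset_insert (Finset.notMem_empty d), Finset.powerset_empty]
  simp only [Finset.sum_singleton, Finset.insert_empty]
  abel

/-- **Two-port form of the star expansion.**  In the situation of `setCS_pair_star_expansion` with `P = {c,d}` (`c ≠ d`, both `≠ s₂`),
for any weight function `u` that agrees with `w` off `s₂` and whose positive-weight pairs at `s₂` end in `c` or `d`:
`CSdiff_u({s₁,s₂}, i) = (1−u_c)(1−u_d)·f_∅ + u_c(1−u_d)·f_c + (1−u_c)u_d·f_d + u_c u_d·f_{cd}` with `u_c = u(s₂c)`, `u_d = u(s₂d)` and the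
off-`s₂` terms `f_B` computed under `w` (`CutObserver.measureReal_preimage_avoid`: they only see the pairs off `s₂`). [folklore] -/
theorem pair_expansion_twoPort (w u : Sym2 (Fin n) → unitInterval) (A : Finset (Fin n)) (s₁ s₂ c d i : Fin n) (j : ℕ)
    (hs₂A : s₂ ∉ A) (h12 : s₁ ≠ s₂) (hi1 : i ≠ s₁) (hi2 : i ≠ s₂) (hcs : c ≠ s₂) (hds : d ≠ s₂) (hcd : c ≠ d)
    (hu : ∀ e : Sym2 (Fin n), s₂ ∉ e → u e = w e) (hobsu : ∀ y, y ≠ s₂ → u s(s₂, y) ≠ 0 → y = c ∨ y = d) :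
    (prodBernoulli u).real {ω : BondConfig (Fin n) | (∀ x ∈ ({s₁, s₂} : Finset (Fin n)), ω ∉ openConn i x) ∧
        (A.filter fun z => ω ∈ openConn i z).card ≤ j} -
      (prodBernoulli u).real {ω : BondConfig (Fin n) | (∀ x ∈ ({s₁, s₂} : Finset (Fin n)), ω ∉ openConn i x) ∧
        1 ≤ (A.filter fun z => ∃ x ∈ ({s₁, s₂} : Finset (Fin n)), ω ∈ openConn x z).card ∧
        (A.filter fun z => ∃ x ∈ ({s₁, s₂} : Finset (Fin n)), ω ∈ openConn x z).card ≤ j} =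
    ∑ B ∈ ({c, d} : Finset (Fin n)).powerset,
      ((if c ∈ B then (u s(s₂, c) : ℝ) else 1 - u s(s₂, c)) * (if d ∈ B then (u s(s₂, d) : ℝ) else 1 - u s(s₂, d))) *
      ((prodBernoulli w).real {ω : BondConfig (Fin n) |
          (∀ y ∈ {s₁} ∪ B, ¬ (openGraph (ω ∩ {e | s₂ ∉ e})).Reachable i y) ∧
            (A.filter fun z => (openGraph (ω ∩ {e | s₂ ∉ e})).Reachable i z).card ≤ j} -
        (prodBernoulli w).real {ω : BondConfig (Fin n) |
          (∀ y ∈ {s₁} ∪ B, ¬ (openGraph (ω ∩ {e | s₂ ∉ e})).Reachable i y) ∧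
            1 ≤ (A.filter fun z => ∃ y ∈ {s₁} ∪ B, (openGraph (ω ∩ {e | s₂ ∉ e})).Reachable y z).card ∧
            (A.filter fun z => ∃ y ∈ {s₁} ∪ B, (openGraph (ω ∩ {e | s₂ ∉ e})).Reachable y z).card ≤ j}) := by
  set P : Finset (Fin n) := {c, d} with hP
  have hs₂P : s₂ ∉ P := by simp [hP, hcs.symm, hds.symm]
  have hobsu' : ∀ y, y ≠ s₂ → y ∉ P → u s(s₂, y) = 0 := by
    intro y hy hyP
    by_contra h
    rcases hobsu y hy h with rfl | rfl <;> simp [hP] at hyP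
  set PL : Finset (Fin n) → BondConfig (Fin n) → Prop := fun B ξ =>
    (∀ y ∈ {s₁} ∪ B, ¬ (openGraph ξ).Reachable i y) ∧
      1 ≤ (A.filter fun z => ∃ y ∈ {s₁} ∪ B, (openGraph ξ).Reachable y z).card ∧
      (A.filter fun z => ∃ y ∈ {s₁} ∪ B, (openGraph ξ).Reachable y z).card ≤ j with hPL
  set PR : Finset (Fin n) → BondConfig (Fin n) → Prop := fun B ξ =>
    (∀ y ∈ {s₁} ∪ B, ¬ (openGraph ξ).Reachable i y) ∧ (A.filter fun z => (openGraph ξ).Reachable i z).card ≤ j with hPR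
  have hwoff : (fun e => if e ∈ {e : Sym2 (Fin n) | s₂ ∉ e} then u e else 0) =
      (fun e => if e ∈ {e : Sym2 (Fin n) | s₂ ∉ e} then w e else 0) := by
    funext e
    by_cases he : s₂ ∉ e
    · simp only [mem_setOf_eq, he, not_false_eq_true, if_true, hu e he]
    · simp only [mem_setOf_eq, he, if_false]
  have hfu : ∀ B : Finset (Fin n),
      (prodBernoulli u).real {ω | PR B (ω ∩ {e | s₂ ∉ e})} - (prodBernoulli u).real {ω | PL B (ω ∩ {e | s₂ ∉ e})} =
        (prodBernoulli w).real {ω | PR B (ω ∩ {e | s₂ ∉ e})} - (prodBernoulli w).real {ω | PL B (ω ∩ {e | s₂ ∉ e})} := by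
    intro B
    have h1 : (prodBernoulli u).real {ω | PR B (ω ∩ {e | s₂ ∉ e})} =
        (prodBernoulli fun e => if e ∈ {e : Sym2 (Fin n) | s₂ ∉ e} then u e else 0).real {ξ | PR B ξ} :=
      measureReal_preimage_avoid u s₂ {ξ | PR B ξ}
    have h2 : (prodBernoulli u).real {ω | PL B (ω ∩ {e | s₂ ∉ e})} =
        (prodBernoulli fun e => if e ∈ {e : Sym2 (Fin n) | s₂ ∉ e} then u e else 0).real {ξ | PL B ξ} :=
      measureReal_preimage_avoid u s₂ {ξ | PL B ξ}
    have h3 : (prodBernoulli w).real {ω | PR B (ω ∩ {e | s₂ ∉ e})} =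
        (prodBernoulli fun e => if e ∈ {e : Sym2 (Fin n) | s₂ ∉ e} then w e else 0).real {ξ | PR B ξ} :=
      measureReal_preimage_avoid w s₂ {ξ | PR B ξ}
    have h4 : (prodBernoulli w).real {ω | PL B (ω ∩ {e | s₂ ∉ e})} =
        (prodBernoulli fun e => if e ∈ {e : Sym2 (Fin n) | s₂ ∉ e} then w e else 0).real {ξ | PL B ξ} :=
      measureReal_preimage_avoid w s₂ {ξ | PL B ξ}
    rw [h1, h2, h3, h4, hwoff]
  rw [setCS_pair_star_expansion u A s₁ s₂ i P j hs₂A h12 hi1 hi2 hs₂P hobsu']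
  refine Finset.sum_congr rfl fun B hB => ?_
  have hBP : B ⊆ P := Finset.mem_powerset.1 hB
  rw [measureReal_starEvent_twoPort u s₂ c d hcs hds hcd hobsu B hBP]
  congr 1
  exact hfu B

end Hyperedge

end Summit.CriticalPhenomena.PercolationContinuityZ3.Theorems

end
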